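import Mathlib
import Literature.NumberTheory.LFunctions.Zhang2022.TypedSection16B
import Literature.NumberTheory.LFunctions.EulerMaclaurinZeta
import Literature.NumberTheory.LFunctions.DirichletLFunctionBounds
import HarnessLib

/-!
# Zhang (2022) §16 p. 94 (u041, "in the same way as Lemma 8.4"): polynomial growth of the repaired
# normaliser `ζ(1+s)²ζ(1+s−β_j)L(1+s,χ)L(1+s−β_j,χ)²` in the strip — pointwise inputs for the contour shift

Topic `Literature/NumberTheory/LFunctions/Zhang2022` (Landau–Siegel audit tree; verdict-neutral).
Y. Zhang, *Discrete mean estimates and the Landau–Siegel zero*, arXiv:2211.02515v1 (2022)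
[Zhang2022LandauSiegel] — **an unrefereed manuscript under adjudication** (ZHANG-L discharge lane,
WP16 Block C, sub-leaf `Typed.Section16B.Step16_u041aR`: "we can move the contour of integration in
the same way as in the proof of Lemma 8.4", §16 p. 94 after Lemma 16.2, tex L4665–L4667).

The contour shift of u041 (tree engine `GaussKernelContour.norm_lineIntegral_sub_residues_le`, kernel
`T^s ω₁(s)/s`) needs sup-bounds `M₀, M₁, M₂` for `Φ(s) = normaliserR c′ χ j (1+s) · U(1+s)` on the right
line, the left line `Re s = a ≥ −1/20` and the horizontals; the factor `U` is bounded by clause (iv) of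
`Lemma162Rp`, and this theorem-only file supplies the other factor, UNIFORMLY IN THE MODULUS, from the
tree's explicit Euler–Maclaurin bound for `ζ` (`norm_riemannZeta_le_of_neg_one_le_re`:
`|ζ(w)| ≤ 1/|w−1| + 1/2 + |w|/12 + |w||w+1||w+2|/48` on `Re w ≥ −1`) and the Abel-summation bound for
`L` (`DirichletZFR.norm_LFunction_le_of_re_ge`: `|L(w,χ)| ≤ D|w|·Σ(n+1)^{−5/4}` on `Re w ≥ 1/4`):

* `norm_riemannZeta_one_add_le` — `|ζ(1+s)| ≤ 1/|s| + (3+|s|)³` (`Re s ≥ −2`, `s ≠ 0`);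
* `norm_LFunction_one_add_le` — `|L(1+s,χ)| ≤ D·Z·(1+|s|)` (`Re s ≥ −3/4`, `χ ≠ χ₀`), `Z = Σ(n+1)^{−5/4}`;
* `norm_normaliserR_one_add_le` — for `Re s ≥ −3/4`, `s ∉ {0, β_j}`, `|β_j| ≤ 1`:
  `|normaliserR(1+s)| ≤ (1/|s| + (3+|s|)³)²·(1/|s−β_j| + (4+|s|)³)·(DZ)³·(1+|s|)(2+|s|)²`;
* `norm_normaliserR_one_add_le_of_le` — the sup form on `{|s| ≤ R, |s| ≥ r₀, |s − β_j| ≥ r₀}`: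
  `≤ (1/r₀ + (4+R)³)³·(4+R)³·Z³·D³` — with `r₀ = 1/20` (left line `Re s = −1/20`; or `r₀ = 1` on
  `Re s = 1`) and `R = H + 2` these are the `M`'s of the engine up to the factor `sup|U|`.

No new definitions, no named facts, no `sorry`; nothing here bears on the residue computation of u041,
on Theorems 1–2 of the source, or on Landau–Siegel zeros.

## References

* Y. Zhang, arXiv:2211.02515v1 (2022), §16 p. 94 (u041); §8 Lemma 8.4 pp. 44–46.
  [cite: Zhang2022LandauSiegel, §16 p.94 (u041)]
* E. C. Titchmarsh, *The Theory of the Riemann Zeta-Function* (2nd ed., 1986), §2.1 (Euler–Maclaurin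
  for `ζ`). [cite: Titchmarsh1986, §2.1]
-/

noncomputable section

open Complex Real Filter Topology
open Literature.NumberTheory.LFunctions.Zhang2022
open Literature.NumberTheory.LFunctions.Zhang2022.Skeleton

namespace Literature.NumberTheory.LFunctions.Zhang2022.Typed.Section16B

/-- **`|ζ(1+s)| ≤ 1/|s| + (3+|s|)³`** for `Re s ≥ −2`, `s ≠ 0` (explicit Euler–Maclaurin bound of the tree,
`|ζ(w)| ≤ 1/|w−1| + 1/2 + |w|/12 + |w||w+1||w+2|/48`, with `|1+s| ≤ 1+|s|` etc.).
[cite: Titchmarsh1986, §2.1] -/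
theorem norm_riemannZeta_one_add_le {s : ℂ} (hs : -2 ≤ s.re) (hs0 : s ≠ 0) :
    ‖riemannZeta (1 + s)‖ ≤ 1 / ‖s‖ + (3 + ‖s‖) ^ 3 := by
  have hw : -1 ≤ (1 + s).re := by rw [Complex.add_re, Complex.one_re]; linarith
  have hw1 : 1 + s ≠ 1 := by
    intro h; exact hs0 (by linear_combination h)
  have h := Literature.NumberTheory.LFunctions.norm_riemannZeta_le_of_neg_one_le_re hw hw1
  rw [add_sub_cancel_left] at h
  have h1 : ‖1 + s‖ ≤ 1 + ‖s‖ := (norm_add_le _ _).trans (by rw [norm_one])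
  have h2 : ‖1 + s + 1‖ ≤ 2 + ‖s‖ := by
    calc ‖1 + s + 1‖ = ‖(2 : ℂ) + s‖ := by ring_nf
      _ ≤ ‖(2 : ℂ)‖ + ‖s‖ := norm_add_le _ _
      _ = 2 + ‖s‖ := by norm_num
  have h3 : ‖1 + s + 2‖ ≤ 3 + ‖s‖ := by
    calc ‖1 + s + 2‖ = ‖(3 : ℂ) + s‖ := by ring_nf
      _ ≤ ‖(3 : ℂ)‖ + ‖s‖ := norm_add_le _ _
      _ = 3 + ‖s‖ := by norm_num
  have hr : 0 ≤ ‖s‖ := norm_nonneg _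
  have hprod : ‖1 + s‖ * ‖1 + s + 1‖ * ‖1 + s + 2‖ ≤ (1 + ‖s‖) * (2 + ‖s‖) * (3 + ‖s‖) :=
    mul_le_mul (mul_le_mul h1 h2 (norm_nonneg _) (by positivity)) h3 (norm_nonneg _) (by positivity)
  calc ‖riemannZeta (1 + s)‖
      ≤ 1 / ‖s‖ + 1 / 2 + ‖1 + s‖ / 12 + ‖1 + s‖ * ‖1 + s + 1‖ * ‖1 + s + 2‖ / 48 := h
    _ ≤ 1 / ‖s‖ + 1 / 2 + (1 + ‖s‖) / 12 + (1 + ‖s‖) * (2 + ‖s‖) * (3 + ‖s‖) / 48 := by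
        gcongr
    _ ≤ 1 / ‖s‖ + (3 + ‖s‖) ^ 3 := by
        have hpoly : 1 / 2 + (1 + ‖s‖) / 12 + (1 + ‖s‖) * (2 + ‖s‖) * (3 + ‖s‖) / 48 ≤
            (3 + ‖s‖) ^ 3 := by
          nlinarith [mul_nonneg hr hr, mul_nonneg (mul_nonneg hr hr) hr]
        linarith

/-- **`|L(1+s,χ)| ≤ D·Z·(1+|s|)`** for `Re s ≥ −3/4` and `χ ≠ χ₀`, `Z = Σ_{n≥0}(n+1)^{−5/4}` (the tree's
Abel-summation bound `|L(w,χ)| ≤ D|w|Z` on `Re w ≥ 1/4`). [cite: Zhang2022LandauSiegel, §8 Lemma 8.4 p.44] -/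
theorem norm_LFunction_one_add_le {D : ℕ} [NeZero D] {χ : DirichletCharacter ℂ D} (hχ : χ ≠ 1)
    {s : ℂ} (hs : -3 / 4 ≤ s.re) :
    ‖χ.LFunction (1 + s)‖ ≤
      (D : ℝ) * (∑' n : ℕ, ((n + 1 : ℕ) : ℝ) ^ (-(5 / 4 : ℝ))) * (1 + ‖s‖) := by
  have hw : 1 / 4 ≤ (1 + s).re := by rw [Complex.add_re, Complex.one_re]; linarith
  have h := DirichletZFR.norm_LFunction_le_of_re_ge χ hχ hw
  have h1 : ‖1 + s‖ ≤ 1 + ‖s‖ := (norm_add_le _ _).trans (by rw [norm_one])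
  have hZ : 0 ≤ ∑' n : ℕ, ((n + 1 : ℕ) : ℝ) ^ (-(5 / 4 : ℝ)) :=
    tsum_nonneg fun n => Real.rpow_nonneg (Nat.cast_nonneg _) _
  calc ‖χ.LFunction (1 + s)‖ ≤ D * ‖1 + s‖ * ∑' n : ℕ, ((n + 1 : ℕ) : ℝ) ^ (-(5 / 4 : ℝ)) := h
    _ ≤ D * (1 + ‖s‖) * ∑' n : ℕ, ((n + 1 : ℕ) : ℝ) ^ (-(5 / 4 : ℝ)) := by gcongr
    _ = (D : ℝ) * (∑' n : ℕ, ((n + 1 : ℕ) : ℝ) ^ (-(5 / 4 : ℝ))) * (1 + ‖s‖) := by ring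

/-- **Polynomial growth of the repaired normaliser at `1+s`**: for `Re s ≥ −3/4`, `s ≠ 0`, `s ≠ β_j`,
`|β_j| ≤ 1` (`Re β_j = 0`) and `χ ≠ χ₀`,
`|ζ(1+s)²ζ(1+s−β_j)L(1+s,χ)L(1+s−β_j,χ)²| ≤ (1/|s| + (3+|s|)³)²·(1/|s−β_j| + (4+|s|)³)·(DZ)³·(1+|s|)(2+|s|)²`.
[cite: Zhang2022LandauSiegel, §16 p.94 (u041)] -/
theorem norm_normaliserR_one_add_le (c' : ℝ) {D : ℕ} [NeZero D] {χ : DirichletCharacter ℂ D}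
    (hχ : χ ≠ 1) (j : ℕ) (hβ : ‖betaJ c' D j‖ ≤ 1) {s : ℂ} (hs : -3 / 4 ≤ s.re) (hs0 : s ≠ 0)
    (hsβ : s ≠ betaJ c' D j) :
    ‖normaliserR c' χ j (1 + s)‖ ≤
      (1 / ‖s‖ + (3 + ‖s‖) ^ 3) ^ 2 * (1 / ‖s - betaJ c' D j‖ + (4 + ‖s‖) ^ 3) *
        ((D : ℝ) * ∑' n : ℕ, ((n + 1 : ℕ) : ℝ) ^ (-(5 / 4 : ℝ))) ^ 3 * ((1 + ‖s‖) * (2 + ‖s‖) ^ 2) := by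
  set Z : ℝ := ∑' n : ℕ, ((n + 1 : ℕ) : ℝ) ^ (-(5 / 4 : ℝ)) with hZ
  set β : ℂ := betaJ c' D j with hβdef
  have hZ0 : 0 ≤ Z := tsum_nonneg fun n => Real.rpow_nonneg (Nat.cast_nonneg _) _
  have hD0 : (0 : ℝ) ≤ D := Nat.cast_nonneg _
  have hβre : β.re = 0 := betaJ_re_eq_zero c' D j
  -- the shifted point `s − β_j`
  have hs' : -3 / 4 ≤ (s - β).re := by rw [Complex.sub_re, hβre, sub_zero]; exact hs
  have hs'2 : -2 ≤ (s - β).re := by linarith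
  have hs2 : -2 ≤ s.re := by linarith
  have hs'0 : s - β ≠ 0 := sub_ne_zero.mpr hsβ
  have hnorm' : ‖s - β‖ ≤ ‖s‖ + 1 := (norm_sub_le _ _).trans (by linarith)
  -- the five factors
  have hζ1 : ‖riemannZeta (1 + s)‖ ≤ 1 / ‖s‖ + (3 + ‖s‖) ^ 3 := norm_riemannZeta_one_add_le hs2 hs0
  have hζ2 : ‖riemannZeta (1 + s - β)‖ ≤ 1 / ‖s - β‖ + (4 + ‖s‖) ^ 3 := by
    rw [add_sub_assoc]
    refine (norm_riemannZeta_one_add_le hs'2 hs'0).trans ?_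
    have : (3 + ‖s - β‖) ^ 3 ≤ (4 + ‖s‖) ^ 3 :=
      pow_le_pow_left₀ (by positivity) (by linarith) 3
    linarith
  have hL1 : ‖χ.LFunction (1 + s)‖ ≤ D * Z * (1 + ‖s‖) := norm_LFunction_one_add_le hχ hs
  have hL2 : ‖χ.LFunction (1 + s - β)‖ ≤ D * Z * (2 + ‖s‖) := by
    rw [add_sub_assoc]
    refine (norm_LFunction_one_add_le hχ hs').trans ?_
    have : (D : ℝ) * Z * (1 + ‖s - β‖) ≤ D * Z * (2 + ‖s‖) :=
      mul_le_mul_of_nonneg_left (by linarith) (by positivity)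
    exact this
  have hA0 : 0 ≤ 1 / ‖s‖ + (3 + ‖s‖) ^ 3 := by positivity
  have hB0 : 0 ≤ 1 / ‖s - β‖ + (4 + ‖s‖) ^ 3 := by positivity
  unfold normaliserR
  rw [← hβdef, norm_mul, norm_mul, norm_mul, norm_pow, norm_pow]
  calc ‖riemannZeta (1 + s)‖ ^ 2 * ‖riemannZeta (1 + s - β)‖ * ‖χ.LFunction (1 + s)‖ *
        ‖χ.LFunction (1 + s - β)‖ ^ 2
      ≤ (1 / ‖s‖ + (3 + ‖s‖) ^ 3) ^ 2 * (1 / ‖s - β‖ + (4 + ‖s‖) ^ 3) * (D * Z * (1 + ‖s‖)) *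
          (D * Z * (2 + ‖s‖)) ^ 2 := by
        refine mul_le_mul (mul_le_mul (mul_le_mul (pow_le_pow_left₀ (norm_nonneg _) hζ1 2) hζ2
          (norm_nonneg _) (by positivity)) hL1 (norm_nonneg _) (by positivity))
          (pow_le_pow_left₀ (norm_nonneg _) hL2 2) (by positivity) (by positivity)
    _ = (1 / ‖s‖ + (3 + ‖s‖) ^ 3) ^ 2 * (1 / ‖s - β‖ + (4 + ‖s‖) ^ 3) * (D * Z) ^ 3 *
          ((1 + ‖s‖) * (2 + ‖s‖) ^ 2) := by ring

/-- **Sup form on a contour region**: if moreover `|s| ≤ R` and `|s|, |s − β_j| ≥ r₀ > 0`, then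
`|normaliserR(1+s)| ≤ (1/r₀ + (4+R)³)³·(4+R)³·Z³·D³` (`Z = Σ(n+1)^{−5/4}`). With `r₀ = 1/20` on the left
line `Re s = −1/20`, `r₀ = 1` on `Re s = 1`, `r₀ = 1` on horizontals `|Im s| = H ≥ 2`, and `R = H + 2`,
these are the normaliser parts of the `M₀, M₁, M₂` of `GaussKernelContour.norm_lineIntegral_sub_residues_le`
for u041. [cite: Zhang2022LandauSiegel, §16 p.94 (u041)] -/
theorem norm_normaliserR_one_add_le_of_le (c' : ℝ) {D : ℕ} [NeZero D] {χ : DirichletCharacter ℂ D}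
    (hχ : χ ≠ 1) (j : ℕ) (hβ : ‖betaJ c' D j‖ ≤ 1) {r₀ R : ℝ} (hr₀ : 0 < r₀) {s : ℂ}
    (hs : -3 / 4 ≤ s.re) (hR : ‖s‖ ≤ R) (hr : r₀ ≤ ‖s‖) (hrβ : r₀ ≤ ‖s - betaJ c' D j‖) :
    ‖normaliserR c' χ j (1 + s)‖ ≤
      (1 / r₀ + (4 + R) ^ 3) ^ 3 * (4 + R) ^ 3 *
        (∑' n : ℕ, ((n + 1 : ℕ) : ℝ) ^ (-(5 / 4 : ℝ))) ^ 3 * (D : ℝ) ^ 3 := by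
  set Z : ℝ := ∑' n : ℕ, ((n + 1 : ℕ) : ℝ) ^ (-(5 / 4 : ℝ)) with hZ
  have hZ0 : 0 ≤ Z := tsum_nonneg fun n => Real.rpow_nonneg (Nat.cast_nonneg _) _
  have hD0 : (0 : ℝ) ≤ D := Nat.cast_nonneg _
  have hs0 : s ≠ 0 := fun h => by rw [h, norm_zero] at hr; linarith
  have hsβ : s ≠ betaJ c' D j := fun h => by rw [h, sub_self, norm_zero] at hrβ; linarith
  have hR0 : 0 ≤ R := (norm_nonneg _).trans hR
  have h := norm_normaliserR_one_add_le c' hχ j hβ hs hs0 hsβ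
  -- compare the factors
  have h1 : 1 / ‖s‖ ≤ 1 / r₀ := div_le_div_of_nonneg_left zero_le_one hr₀ hr
  have h2 : 1 / ‖s - betaJ c' D j‖ ≤ 1 / r₀ := div_le_div_of_nonneg_left zero_le_one hr₀ hrβ
  have h3 : (3 + ‖s‖) ^ 3 ≤ (4 + R) ^ 3 := pow_le_pow_left₀ (by positivity) (by linarith) 3
  have h4 : (4 + ‖s‖) ^ 3 ≤ (4 + R) ^ 3 := pow_le_pow_left₀ (by positivity) (by linarith) 3
  have hA : 1 / ‖s‖ + (3 + ‖s‖) ^ 3 ≤ 1 / r₀ + (4 + R) ^ 3 := add_le_add h1 h3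
  have hB : 1 / ‖s - betaJ c' D j‖ + (4 + ‖s‖) ^ 3 ≤ 1 / r₀ + (4 + R) ^ 3 := add_le_add h2 h4
  have hC : (1 + ‖s‖) * (2 + ‖s‖) ^ 2 ≤ (4 + R) ^ 3 := by
    calc (1 + ‖s‖) * (2 + ‖s‖) ^ 2 ≤ (4 + R) * (4 + R) ^ 2 :=
          mul_le_mul (by linarith) (pow_le_pow_left₀ (by positivity) (by linarith) 2)
            (by positivity) (by positivity)
      _ = (4 + R) ^ 3 := by ring
  have hA0 : 0 ≤ 1 / ‖s‖ + (3 + ‖s‖) ^ 3 := by positivity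
  have hB0 : 0 ≤ 1 / ‖s - betaJ c' D j‖ + (4 + ‖s‖) ^ 3 := by positivity
  calc ‖normaliserR c' χ j (1 + s)‖
      ≤ (1 / ‖s‖ + (3 + ‖s‖) ^ 3) ^ 2 * (1 / ‖s - betaJ c' D j‖ + (4 + ‖s‖) ^ 3) *
          ((D : ℝ) * Z) ^ 3 * ((1 + ‖s‖) * (2 + ‖s‖) ^ 2) := h
    _ ≤ (1 / r₀ + (4 + R) ^ 3) ^ 2 * (1 / r₀ + (4 + R) ^ 3) * ((D : ℝ) * Z) ^ 3 * (4 + R) ^ 3 := by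
        refine mul_le_mul (mul_le_mul_of_nonneg_right (mul_le_mul (pow_le_pow_left₀ hA0 hA 2) hB hB0
          (by positivity)) (by positivity)) hC (by positivity) (by positivity)
    _ = (1 / r₀ + (4 + R) ^ 3) ^ 3 * (4 + R) ^ 3 * Z ^ 3 * (D : ℝ) ^ 3 := by ring

/-- **Holomorphy of the repaired normaliser at `1+s` off `{0, β_j}`** (`ζ` is holomorphic off `1`,
`L(·,χ)` entire for `χ ≠ χ₀`). [cite: Zhang2022LandauSiegel, §16 p.94 (u041)] -/
theorem differentiableAt_normaliserR_one_add (c' : ℝ) {D : ℕ} [NeZero D] {χ : DirichletCharacter ℂ D}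
    (hχ : χ ≠ 1) (j : ℕ) {s : ℂ} (hs0 : s ≠ 0) (hsβ : s ≠ betaJ c' D j) :
    DifferentiableAt ℂ (fun z : ℂ => normaliserR c' χ j (1 + z)) s := by
  have h1 : (1 : ℂ) + s ≠ 1 := fun h => hs0 (by linear_combination h)
  have h2 : (1 : ℂ) + s - betaJ c' D j ≠ 1 := fun h => hsβ (by linear_combination h)
  have hL := DirichletCharacter.differentiable_LFunction hχ
  have hlin : DifferentiableAt ℂ (fun z : ℂ => (1 : ℂ) + z) s :=
    (differentiableAt_const _).add differentiableAt_id
  have hlin' : DifferentiableAt ℂ (fun z : ℂ => (1 : ℂ) + z - betaJ c' D j) s := hlin.sub_const _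
  have hζa : DifferentiableAt ℂ (fun z : ℂ => riemannZeta (1 + z)) s :=
    (differentiableAt_riemannZeta h1).comp s hlin
  have hζb : DifferentiableAt ℂ (fun z : ℂ => riemannZeta (1 + z - betaJ c' D j)) s :=
    (differentiableAt_riemannZeta h2).comp s hlin'
  have hLa : DifferentiableAt ℂ (fun z : ℂ => χ.LFunction (1 + z)) s := (hL _).comp s hlin
  have hLb : DifferentiableAt ℂ (fun z : ℂ => χ.LFunction (1 + z - betaJ c' D j)) s :=
    (hL _).comp s hlin'
  unfold normaliserR
  exact (((hζa.pow 2).mul hζb).mul hLa).mul (hLb.pow 2)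

/-- The same as a `DifferentiableOn` statement on `{s | s ≠ 0 ∧ s ≠ β_j}`.
[cite: Zhang2022LandauSiegel, §16 p.94 (u041)] -/
theorem differentiableOn_normaliserR_one_add (c' : ℝ) {D : ℕ} [NeZero D] {χ : DirichletCharacter ℂ D}
    (hχ : χ ≠ 1) (j : ℕ) :
    DifferentiableOn ℂ (fun z : ℂ => normaliserR c' χ j (1 + z)) {s : ℂ | s ≠ 0 ∧ s ≠ betaJ c' D j} :=
  fun _ hs => (differentiableAt_normaliserR_one_add c' hχ j hs.1 hs.2).differentiableWithinAt

end Literature.NumberTheory.LFunctions.Zhang2022.Typed.Section16B
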